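import Summits.HodgeConjecture.CorCM.Model.RosatiTheta
import Summits.HodgeConjecture.CorCM.Model.PolarContraction
import Summits.HodgeConjecture.CorCM.Model.RosatiTensorOfAdjoint
import Summits.HodgeConjecture.CorCM.Model.LefschetzPowToCupPow
import Summits.HodgeConjecture.CorCM.Model.PolarizationDatum
import Summits.HodgeConjecture.CorCM.Model.Prod4Degree
import Literature.AlgebraicTopology.SingularHomology.KunnethFormula
import HarnessLib

/-!
# COR-CM model layer (row M22 `Fact_algDuality`, input R2 → P, route Σ file Σ2): the Rosati TENSOR identity
# for one coded CM factor

Cell `pub-hodgecm2` (COR-CM = stage 2 of the Hodge ladder), seat `b13` (row M22 input R2).  For the CM abelian variety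
`A_c = Var.cm c` of a CM code `c = (E, Φ)` of the Picard–CM universe and an abstract field `K ≃+* E`, this file produces
(`var_exists_rosatiTensor`): a rational algebraic class `θ ∈ alg (cm c) 1`, a basis `b` of `H¹(A_c(ℂ); ℚ)` and a SECOND
basis `y` — the polar family of `θ` along `b`, `m^*θ - pr₁^*θ - pr₂^*θ = Σ_a pr₁^* b_a ∪ pr₂^* y_a` (the hypothesis `hℓ` of
K-b's `Model.sum_pull_cupPowOne_cup_mem_ratAlgebraicClasses`) — such that for EVERY `x ∈ K`

  `Σ_a ι(x) b_a ⊗ y_a = Σ_a b_a ⊗ ι(x̄) y_a`  in `H¹(A_c; ℚ) ⊗_ℚ H¹(A_c; ℚ)`,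

`ι = (BettiUniverse.cmEndAction …).ι` the model's rational `K`-action on `H¹` (the `cmAct` of `Model.universeOf`, the
spelling of row M19's `IsDiagAct` and of the M22 socket `Model.pull_comp_fourierSum_comp_pull_eq_smul` /
`Model.var_algDuality`), `x̄ = cmConjRingHom K x`.

Proof (no new mathematics, def-free): part A (`Model.var_exists_rosatiTheta_cmAction`, Shimura 1998 §6.2 Thm. 4 (3)
transcribed) gives `θ` with `θ^g ≠ 0` and the ADJOINTNESS `Q_θ(ι(x) u, v) = Q_θ(u, ι(x̄) v)` of the polarization pairing
`Q_θ(u, v) = θ^{g-1} ⌣ (u ⌣ v)`; K-b part 3 (`Model.smul_cup_polar_cup_cupPow`, b16) gives the DUALITY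
`g • b_a ⌣ y_{a'} ⌣ θ^{g-1} = δ_{a a'} θ^g` of the polar family; the linear-algebra lemma
`Model.sum_tmul_map_eq_sum_tmul_map_of_adjoint` (file Σ1) turns adjoint pair + dual pair into the tensor identity.  The
only glue is the spelling bridge `Lᵏ_θ z = z ⌣ θᵏ` between the tree's Lefschetz iterate `Kaehler.lefschetzPow`
(left iterated cup products, used by `Motives.polarizationPairingOne` and part A) and `CharacteristicClasses.cupPow`
(right powers, used by K-b), §1; the non-vanishing `θ^g ≠ 0` crosses the same bridge through b03's
`Model.cupPow_ne_zero_of_lefschetzPowTo_bettiOne_ne_zero` (`CorCM/Model/LefschetzPowToCupPow.lean`).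

References: G. Shimura, *Abelian Varieties with Complex Multiplication and Modular Functions* (1998) §6.2 Thm. 4;
D. Mumford, *Abelian Varieties* (1970) §16, §20; H. Lange, Ch. Birkenhake, *Complex Abelian Varieties* (1992) §5.1.
-/

noncomputable section

open CategoryTheory MonoidalCategory CartesianMonoidalCategory
open NumberField
open Literature.AlgebraicTopology.SingularHomology
open Literature.AlgebraicTopology.CharacteristicClasses (cupPow cupPow_zero cupPow_succ)
open Literature.Geometry.Kaehler
open Literature.AlgebraicGeometry.Motives (SchemeOver ComplexPoints IsSmoothProjective bettiCohomology bettiOne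
  AbelianVariety)
open Literature.AlgebraicGeometry.HodgeTheory
open Literature.AlgebraicGeometry.ComplexMultiplication
open Literature.NumberTheory.Automorphic Literature.NumberTheory.Automorphic.PicardCM
open scoped TensorProduct MonObj

namespace Summit.HodgeConjecture.CorCM.Model

/-! ### §1 Spelling bridge: Lefschetz iterates are cup products with cup powers -/

section Bridge

variable {T : Type} [TopologicalSpace T]

/-- **`Lᵏ_θ z = z ⌣ θᵏ`**: the `k`-th Lefschetz iterate `θ ⌣ (θ ⌣ ⋯ (θ ⌣ z))` (`Kaehler.lefschetzPow θ k d`) of a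
degree-`d` class is its cup product with the `k`-th cup power `θᵏ = ((1 ⌣ θ) ⌣ θ) ⋯ ⌣ θ` (`CharacteristicClasses.cupPow`),
by associativity and the commutation of the degree-two class `θ` with every class. [cite: HatcherAT2002, §3.2 Thm. 3.11] -/
theorem lefschetzPow_eq_cupProduct_cupPow (θ : singularCohomology ℚ ℚ T 2) (d : ℕ) :
    ∀ (k : ℕ) (z : singularCohomology ℚ ℚ T d),
      lefschetzPow θ k d z = cupProduct (rfl : d + 2 * k = d + 2 * k) z (cupPow ℚ θ k)
  | 0, z => by
    rw [lefschetzPow_zero, LinearMap.id_apply]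
    exact (cupProduct_one z).symm
  | k + 1, z => by
    rw [lefschetzPow_succ, LinearMap.comp_apply, lefschetzOperator_apply, lefschetzPow_eq_cupProduct_cupPow θ d k z,
      ← cupProduct_assoc (rfl : 2 + d = 2 + d) (rfl : d + 2 * k = d + 2 * k)
        (by omega : 2 + d + 2 * k = d + 2 * (k + 1)),
      ← cupProduct_comm_deg_two (by omega : d + 2 = 2 + d) rfl z θ,
      cupProduct_assoc (by omega : d + 2 = 2 + d) (by omega : 2 + 2 * k = 2 * (k + 1))
        (by omega : 2 + d + 2 * k = d + 2 * (k + 1)) rfl,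
      ← cupProduct_comm_deg_two (by omega : 2 * k + 2 = 2 * (k + 1)) (by omega : 2 + 2 * k = 2 * (k + 1))
        (cupPow ℚ θ k) θ,
      ← cupPow_succ]

/-- Degree transport of a cup product: `cast (a ⌣ c) = a ⌣ c` with the transported degree equation. [folklore] -/
theorem castDeg_cupProduct {p q n n' : ℕ} (h : p + q = n) (e : n = n') (a : singularCohomology ℚ ℚ T p)
    (c : singularCohomology ℚ ℚ T q) : LerayHirsch.castDeg ℚ e (cupProduct h a c) = cupProduct (h.trans e) a c := by
  subst e
  rfl

/-- **The pairing bridge**: K-b's form `u ⌣ (v ⌣ θᵏ) ∈ H^{(2k+1)+1}` is part A's / `Motives.polarizationPairingOne`'s form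
`Lᵏ_θ (u ⌣ v) ∈ H^{2+2k}` up to the degree cast (associativity + §1). [cite: HatcherAT2002, §3.2 Prop. 3.10] -/
theorem cup_cup_cupPow_eq_castDeg_lefschetzPow (θ : singularCohomology ℚ ℚ T 2) (k : ℕ)
    (u v : singularCohomology ℚ ℚ T 1) :
    cupProduct (Nat.add_comm 1 (2 * k + 1)) u (cupProduct (show 1 + 2 * k = 2 * k + 1 by omega) v (cupPow ℚ θ k)) =
      LerayHirsch.castDeg ℚ (by omega : 2 + 2 * k = 2 * k + 1 + 1) (lefschetzPow θ k 2 (cupProduct rfl u v)) := by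
  rw [lefschetzPow_eq_cupProduct_cupPow, castDeg_cupProduct]
  exact (cupProduct_assoc rfl _ _ _ u v _).symm

end Bridge

/-! ### §2 One coded factor -/

section Factor

/-- **The Rosati tensor identity for one coded CM factor.**  For a CM code `c = (E, Φ)` and `e : K ≃+* E` there are a
rational algebraic class `θ ∈ alg (cm c) 1` (`= ratAlgebraicClasses A_c 1`) and two bases `b`, `y` of `H¹(A_c(ℂ); ℚ)`,
`y` the POLAR FAMILY of `θ` along `b` (`m^*θ - pr₁^*θ - pr₂^*θ = Σ_a pr₁^* b_a ∪ pr₂^* y_a` on `A_c × A_c`, for the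
group law of the realising abelian variety `(cmRealisation h₃ c).AV`), such that for every `x ∈ K`
`Σ_a ι(x) b_a ⊗ y_a = Σ_a b_a ⊗ ι(x̄) y_a` in `H¹ ⊗_ℚ H¹`, where `ι` is the model's rational `K`-action
`(BettiUniverse.cmEndAction ((cmRealisation h₃ c).θ.comp e) _ hHD hI _).ι` on `H¹(A_c(ℂ); ℚ)` and `x̄ = cmConjRingHom K x`
— the Rosati involution of the polarization `θ` is complex conjugation on `K`, in tensor form.  Assembled from part A
(`var_exists_rosatiTheta_cmAction`: `θ`, `θ^g ≠ 0`, adjointness of `Q_θ`), K-b (`exists_polClass_eq_sum`,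
`smul_cup_polar_cup_cupPow`: the polar family and its `Q_θ`-duality) and Σ1 (`sum_tmul_map_eq_sum_tmul_map_of_adjoint`).
[cite: Shimura1998, §6.2 Thm. 4] [cite: MumfordAV1970, §16 and §20] -/
theorem var_exists_rosatiTensor (hHD : exists_isReal_hodgeModel) (hI : hodgePQ_independent_of_hodgeModel)
    (hU : BallQuotientUniformisedDatum) (h₃ : CMAbelianVarietyRealised) (c : CMCode) {K : Type} [Field K]
    [NumberField K] [IsCMField K] (e : K ≃+* c.E) :
    ∃ θ : Var.Coh hU h₃ (.cm c) 2, θ ∈ Var.alg hU h₃ (.cm c) 1 ∧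
      ∃ (N : ℕ) (b y : Module.Basis (Fin N) ℚ (Var.Coh hU h₃ (.cm c) 1)),
        BettiUniverse.pull μ[(cmRealisation h₃ c).AV.X] 2 θ -
              BettiUniverse.pull (fst (cmRealisation h₃ c).AV.X (cmRealisation h₃ c).AV.X) 2 θ -
              BettiUniverse.pull (snd (cmRealisation h₃ c).AV.X (cmRealisation h₃ c).AV.X) 2 θ =
            ∑ a, BettiUniverse.cup ((cmRealisation h₃ c).AV.X ⊗ (cmRealisation h₃ c).AV.X) 1 1
              (BettiUniverse.pull (fst (cmRealisation h₃ c).AV.X (cmRealisation h₃ c).AV.X) 1 (b a))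
              (BettiUniverse.pull (snd (cmRealisation h₃ c).AV.X (cmRealisation h₃ c).AV.X) 1 (y a)) ∧
        ∀ x : K,
          ∑ a, (BettiUniverse.cmEndAction ((cmRealisation h₃ c).θ.comp e.toRingHom)
                ((cmRealisation h₃ c).exists_map_comp e) hHD hI (Var.isSmoothProjective hU h₃ (.cm c))).ι x (b a)
              ⊗ₜ[ℚ] y a =
            ∑ a, b a ⊗ₜ[ℚ] (BettiUniverse.cmEndAction ((cmRealisation h₃ c).θ.comp e.toRingHom)
                ((cmRealisation h₃ c).exists_map_comp e) hHD hI (Var.isSmoothProjective hU h₃ (.cm c))).ι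
              (cmConjRingHom K x) (y a) := by
  classical
  obtain ⟨θ, hθalg, hθtop, hros⟩ := var_exists_rosatiTheta_cmAction hU h₃ c e
  -- a basis `b` of `H¹` and the polar family `y` of `θ` along it
  haveI : Module.Finite ℚ (Var.Coh hU h₃ (.cm c) 1) := Var.finite hU h₃ _ 1
  let b : Module.Basis (Fin (Module.finrank ℚ (Var.Coh hU h₃ (.cm c) 1))) ℚ (Var.Coh hU h₃ (.cm c) 1) :=
    Module.finBasis ℚ _
  obtain ⟨y, hℓ⟩ := exists_polClass_eq_sum (cmRealisation h₃ c).AV b θ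
  -- degrees: `g = dim A_c ≥ 1`, `k = g - 1`
  have hg1 : 1 ≤ Var.dim (.cm c) := one_le_dim_cm c
  have hk : Var.dim (.cm c) - 1 + 1 = (cmRealisation h₃ c).AV.dim := by
    rw [dim_cmRealisation h₃ c]; omega
  -- `θ^g ≠ 0` in the `cupPow` spelling
  have hθpow : cupPow ℚ θ (Var.dim (.cm c) - 1 + 1) ≠ 0 := by
    rw [Nat.sub_add_cancel hg1]
    exact cupPow_ne_zero_of_lefschetzPowTo_bettiOne_ne_zero hθtop
  -- the polarization pairing `Q u v = u ⌣ (v ⌣ θ^{g-1})` (K-b's spelling), its duality and adjointness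
  let Q : Var.Coh hU h₃ (.cm c) 1 →ₗ[ℚ] Var.Coh hU h₃ (.cm c) 1 →ₗ[ℚ]
      Var.Coh hU h₃ (.cm c) (2 * (Var.dim (.cm c) - 1) + 1 + 1) :=
    (cupProduct (Nat.add_comm 1 (2 * (Var.dim (.cm c) - 1) + 1))).compl₂
      ((cupProduct (show 1 + 2 * (Var.dim (.cm c) - 1) = 2 * (Var.dim (.cm c) - 1) + 1 by omega)).flip
        (cupPow ℚ θ (Var.dim (.cm c) - 1)))
  have hQ : ∀ u v, Q u v = cupProduct (Nat.add_comm 1 (2 * (Var.dim (.cm c) - 1) + 1)) u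
      (cupProduct (show 1 + 2 * (Var.dim (.cm c) - 1) = 2 * (Var.dim (.cm c) - 1) + 1 by omega) v
        (cupPow ℚ θ (Var.dim (.cm c) - 1))) := fun u v ↦ rfl
  have hne : ((Var.dim (.cm c) - 1 + 1 : ℕ) : ℚ) ≠ 0 := Nat.cast_ne_zero.2 (by omega)
  have hw₀ : ((Var.dim (.cm c) - 1 + 1 : ℕ) : ℚ)⁻¹ • cupPow ℚ θ (Var.dim (.cm c) - 1 + 1) ≠ 0 :=
    smul_ne_zero (inv_ne_zero hne) hθpow
  have hQdual : ∀ a a', Q (b a) (y a') =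
      if a = a' then ((Var.dim (.cm c) - 1 + 1 : ℕ) : ℚ)⁻¹ • cupPow ℚ θ (Var.dim (.cm c) - 1 + 1) else 0 := by
    intro a a'
    have h : ((Var.dim (.cm c) - 1 + 1 : ℕ) : ℚ) • Q (b a) (y a') =
        if a = a' then cupPow ℚ θ (Var.dim (.cm c) - 1 + 1) else 0 :=
      smul_cup_polar_cup_cupPow (cmRealisation h₃ c).AV hk b hℓ a a'
    calc Q (b a) (y a')
        = ((Var.dim (.cm c) - 1 + 1 : ℕ) : ℚ)⁻¹ • (((Var.dim (.cm c) - 1 + 1 : ℕ) : ℚ) • Q (b a) (y a')) := by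
          rw [smul_smul, inv_mul_cancel₀ hne, one_smul]
      _ = ((Var.dim (.cm c) - 1 + 1 : ℕ) : ℚ)⁻¹ • (if a = a' then cupPow ℚ θ (Var.dim (.cm c) - 1 + 1) else 0) := by
          rw [h]
      _ = _ := by
          split_ifs
          · rfl
          · exact smul_zero _
  refine ⟨θ, hθalg, _, b, basisOfLinearIndependentOfCardEqFinrank' y
    (linearIndependent_of_dualFamily Q b y _ hw₀ hQdual) (Module.finrank_eq_card_basis b).symm, ?_, fun x ↦ ?_⟩
  · simp only [coe_basisOfLinearIndependentOfCardEqFinrank']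
    exact hℓ
  · simp only [coe_basisOfLinearIndependentOfCardEqFinrank']
    refine sum_tmul_map_eq_sum_tmul_map_of_adjoint Q b y hw₀ hQdual fun u v ↦ ?_
    rw [hQ, hQ, cup_cup_cupPow_eq_castDeg_lefschetzPow, cup_cup_cupPow_eq_castDeg_lefschetzPow]
    exact congrArg _ (hros x u v)

end Factor

end Summit.HodgeConjecture.CorCM.Model

end
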